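import Literature.MathematicalPhysics.QuantumLattice.SectorisedEffectiveActionBoundPlateau
import Literature.MathematicalPhysics.QuantumLattice.GrassmannEffectiveActionBoundDB
import Literature.MathematicalPhysics.QuantumLattice.GrassmannEffectiveActionNorm
import Literature.MathematicalPhysics.QuantumLattice.GrassmannKernelsPresented
import HarnessLib

/-!
# The sectorised single-scale step (S1) in DETERMINANT-BOUND currency (`IsGramBoundedR`), plateau form

Topic `MathematicalPhysics/QuantumLattice`; sequel of `SectorisedEffectiveActionBoundPlateau` (the step with the support
hypothesis on the slice and the output family instead of the input) and of `GrassmannEffectiveActionBoundDB`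
(`sum_norm_kernel_effAction_le_of_gramBounded`: the single-scale step from a replica-stable Gram / determinant bound
`IsGramBoundedR C κ` of de Siqueira Pedra–Salmhofer type instead of an explicit Gram representation).  The sector-propagator
suppliers of the KL programme (`isGramBoundedR_sliceCT_bgmFat`, …SectorSliceGram(Fat)) deliver `IsGramBoundedR`; this file is
the step they plug into.

* `kernelNorm_kernel_effAction_le_of_gramBounded` — the flat step in `kernelNorm 1` form for a GENERAL even input
  (the `IsGramBoundedR` twin of `GrassmannEffectiveActionNorm.kernelNorm_kernel_effAction_le`);
* `kernelNorm_kernel_map_effAction_le_of_gramBounded` — read in another representation of the fields (the `IsGramBoundedR`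
  twin of `GrassmannEffectiveActionRepresentation.kernelNorm_kernel_map_effAction_le`: input `V = map f Ṽ`, analysis map `g`);
* **`kernelNorm_sectorAnalysis_effAction_le_of_gramBounded_of_plateau`**, **`hubbardSectorKernelNorm_effAction_le_of_gramBounded_of_plateau`**,
  **`hubbardSectorKernelNorm_effAction_le_of_sectorNorm_of_gramBounded_of_plateau`** — the sectorised step for the Hubbard
  torus: families `F` (thin), `F̃` (fat, `F̃F = F`), output family `F′`; slice `C` with `IsGramBoundedR (S(F̃)ᵀ C S(F̃)) κ` and
  row/column sums `≤ α`; plateau of `F` required only over the slice and the output family; ANY even input `G` without constant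
  part; conclusion: `∫dμ_C e^{-G}` is a unit and the BGM (2.77) bound in every degree with the input norm `‖G‖_{F, univ}`.

Everything is proved; no definitions; no named facts.

## Sources

G. Benfatto, A. Giuliani, V. Mastropietro, Ann. Henri Poincaré 7 (2006) 809–898 = arXiv:cond-mat/0507686, §2.7 (2.70)–(2.71a),
§2.8 (2.76)–(2.83) [`BenfattoGiulianiMastropietro2006`]; W. de Siqueira Pedra, M. Salmhofer, Comm. Math. Phys. 282 (2008) 797–818,
Thm 1.3 [`PedraSalmhofer2008`].
-/

noncomputable section

namespace Literature.MathematicalPhysics.QuantumLattice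

open GrassmannAlgebra Finset Literature.Probability.LatticeModels

universe u

/-! ### The flat step and its reading in another representation, determinant-bound currency -/

section Generic

variable {𝕜 : Type*} [RCLike 𝕜] {Γ Γ' Γ'' : Type u} [Fintype Γ] [DecidableEq Γ] [Fintype Γ'] [DecidableEq Γ']
  [Fintype Γ''] [DecidableEq Γ'']

/-- **The single-scale step in `kernelNorm`, determinant-bound currency** (BGM 2006, (2.13)–(2.14) with (2.77)–(2.80); Gram
constant from `IsGramBoundedR`): with `‖V‖_h = normV Γ κ ρ (m' ↦ kernelNorm 1 (2m') (kernel V (2m')))` and `θ = eα‖V‖_h/κ² < 1`,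
the normalised partition function is a unit and `kernelNorm 1 m (kernel (effAction C V) m) ≤ ρ^{-m} e‖V‖_h/(1-θ)` for every
`m ≥ 1`. [cite: BenfattoGiulianiMastropietro2006, (2.13)-(2.14) and (2.77)-(2.80)] -/
theorem kernelNorm_kernel_effAction_le_of_gramBounded (C : Matrix Γ Γ 𝕜) {κ : ℝ} (hκ : 0 < κ) (hGB : IsGramBoundedR C κ)
    (V : GrassmannAlgebra 𝕜 Γ) (hV : V ∈ evenPart 𝕜 Γ) (hV0 : constPart 𝕜 V = 0)
    {α : ℝ} (hα : 0 < α) (hrow : ∀ X, ∑ Y, ‖C X Y‖ ≤ α) (hcol : ∀ Y, ∑ X, ‖C X Y‖ ≤ α) {ρ : ℝ} (hρ : 0 < ρ)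
    (hθ : Real.exp 1 * α * normV Γ κ ρ (fun m' => kernelNorm 1 (2 * m') (kernel 𝕜 V (2 * m'))) / κ ^ 2 < 1) :
    IsUnit (effPartitionFn 𝕜 C V) ∧ ∀ {m : ℕ}, 0 < m →
      kernelNorm 1 m (kernel 𝕜 (effAction 𝕜 C V) m) ≤
        ρ⁻¹ ^ m * (Real.exp 1 * normV Γ κ ρ (fun m' => kernelNorm 1 (2 * m') (kernel 𝕜 V (2 * m')))) /
          (1 - Real.exp 1 * α * normV Γ κ ρ (fun m' => kernelNorm 1 (2 * m') (kernel 𝕜 V (2 * m'))) / κ ^ 2) := by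
  set N : ℕ → ℝ := fun m' => kernelNorm 1 (2 * m') (kernel 𝕜 V (2 * m')) with hN
  have hN0 : ∀ m', 0 ≤ N m' := fun m' => kernelNorm_nonneg zero_le_one _ _
  obtain ⟨hunit, hbd⟩ := sum_norm_kernel_effAction_le_of_gramBounded C hκ hGB V hV hV0 N hN0
    (fun m' j w => pinnedSum_le_kernelNorm_one _ j w) hα hrow hcol hρ hθ
  refine ⟨hunit, fun {m} hm => ?_⟩
  have hnV0 : 0 ≤ normV Γ κ ρ N := normV_nonneg hκ.le hρ.le hN0
  obtain ⟨q, rfl⟩ : ∃ q, m = q + 1 := ⟨m - 1, by omega⟩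
  exact kernelNorm_succ_le_of_forall 1 q _ (div_nonneg (by positivity) (sub_nonneg.2 hθ.le)) fun p x => by
    rw [one_pow, one_mul]
    exact hbd hm p x

/-- **The determinant-bounded step read in another representation of the fields** (the `IsGramBoundedR` twin of
`kernelNorm_kernel_map_effAction_le`; BGM 2006, (2.77) with (2.71a), (2.80)–(2.82)).  `V = map f Ṽ`, `Ṽ` even without constant
part; the pulled-back covariance `C' = Mᵀ C M` replica-Gram-bounded with constant `κ` and with row/column sums `≤ α`;
`θ = eα‖Ṽ‖_h/κ² < 1`; the analysis map `g` with `Σ_{X'} ‖(E M)(X'', X')‖ ≤ cr`, `Σ_{X''} ‖(E M)(X'', X')‖ ≤ cc`.  THEN `∫dμ_C e^{-V}` is a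
unit and, in every degree `m + 1`, `‖kernel (map g (effAction C V)) (m+1)‖_ε ≤ cr · cc^m · ε^m · ρ^{-(m+1)} · e‖Ṽ‖_h/(1-θ)`.
[cite: BenfattoGiulianiMastropietro2006, (2.77) with (2.71a) and (2.80)-(2.82)] -/
theorem kernelNorm_kernel_map_effAction_le_of_gramBounded
    (C : Matrix Γ Γ 𝕜) (f : (Γ' → 𝕜) →ₗ[𝕜] (Γ → 𝕜)) (g : (Γ → 𝕜) →ₗ[𝕜] (Γ'' → 𝕜))
    (Vt : GrassmannAlgebra 𝕜 Γ') (hVt : Vt ∈ evenPart 𝕜 Γ') (hVt0 : constPart 𝕜 Vt = 0)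
    {κ : ℝ} (hκ : 0 < κ) (hGB : IsGramBoundedR ((LinearMap.toMatrix' f).transpose * C * LinearMap.toMatrix' f) κ)
    {α : ℝ} (hα : 0 < α)
    (hrow : ∀ X, ∑ Y, ‖((LinearMap.toMatrix' f).transpose * C * LinearMap.toMatrix' f) X Y‖ ≤ α)
    (hcol : ∀ Y, ∑ X, ‖((LinearMap.toMatrix' f).transpose * C * LinearMap.toMatrix' f) X Y‖ ≤ α)
    {ρ : ℝ} (hρ : 0 < ρ)
    (hθ : Real.exp 1 * α * normV Γ' κ ρ (fun m' => kernelNorm 1 (2 * m') (kernel 𝕜 Vt (2 * m'))) / κ ^ 2 < 1)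
    {cr cc : ℝ} (hcr0 : 0 ≤ cr) (hcc0 : 0 ≤ cc)
    (hrow' : ∀ X'', ∑ X', ‖(LinearMap.toMatrix' g * LinearMap.toMatrix' f) X'' X'‖ ≤ cr)
    (hcol' : ∀ X', ∑ X'', ‖(LinearMap.toMatrix' g * LinearMap.toMatrix' f) X'' X'‖ ≤ cc)
    {ε : ℝ} (hε : 0 ≤ ε) :
    IsUnit (effPartitionFn 𝕜 C (ExteriorAlgebra.map f Vt)) ∧ ∀ m : ℕ,
      kernelNorm ε (m + 1) (kernel 𝕜 (ExteriorAlgebra.map g (effAction 𝕜 C (ExteriorAlgebra.map f Vt))) (m + 1)) ≤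
        cr * cc ^ m * ε ^ m * (ρ⁻¹ ^ (m + 1) *
          (Real.exp 1 * normV Γ' κ ρ (fun m' => kernelNorm 1 (2 * m') (kernel 𝕜 Vt (2 * m')))) /
            (1 - Real.exp 1 * α * normV Γ' κ ρ (fun m' => kernelNorm 1 (2 * m') (kernel 𝕜 Vt (2 * m'))) / κ ^ 2)) := by
  set C' : Matrix Γ' Γ' 𝕜 := (LinearMap.toMatrix' f).transpose * C * LinearMap.toMatrix' f with hC'
  -- the single-scale step in the auxiliary representation
  obtain ⟨hunit, hbd⟩ := kernelNorm_kernel_effAction_le_of_gramBounded C' hκ hGB Vt hVt hVt0 hα hrow hcol hρ hθ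
  refine ⟨by rwa [effPartitionFn_map], fun m => ?_⟩
  -- the output read through `g`: kernels of `map (g ∘ f) (effAction C' Ṽ)`
  rw [effAction_map, map_map_eq_map_comp, kernelNorm_eq_pow_mul_kernelNorm_one hε]
  have hY := kernelNorm_kernel_map_le (g ∘ₗ f) hcr0 hcc0 (ε := 1)
    (by intro X''; rw [LinearMap.toMatrix'_comp]; exact hrow' X'')
    (by intro X'; simp only [LinearMap.toMatrix'_comp]; exact hcol' X') zero_le_one (effAction 𝕜 C' Vt) m
  calc ε ^ m * kernelNorm 1 (m + 1) (kernel 𝕜 (ExteriorAlgebra.map (g ∘ₗ f) (effAction 𝕜 C' Vt)) (m + 1))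
      ≤ ε ^ m * (cr * cc ^ m * kernelNorm 1 (m + 1) (kernel 𝕜 (effAction 𝕜 C' Vt) (m + 1))) :=
        mul_le_mul_of_nonneg_left hY (pow_nonneg hε _)
    _ ≤ ε ^ m * (cr * cc ^ m * (ρ⁻¹ ^ (m + 1) *
          (Real.exp 1 * normV Γ' κ ρ (fun m' => kernelNorm 1 (2 * m') (kernel 𝕜 Vt (2 * m')))) /
            (1 - Real.exp 1 * α * normV Γ' κ ρ (fun m' => kernelNorm 1 (2 * m') (kernel 𝕜 Vt (2 * m'))) / κ ^ 2))) := by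
        exact mul_le_mul_of_nonneg_left (mul_le_mul_of_nonneg_left (hbd (Nat.succ_pos m)) (by positivity))
          (pow_nonneg hε _)
    _ = _ := by ring

end Generic

/-! ### The sectorised step for the Hubbard torus, determinant-bound currency, plateau form -/

section Step

open scoped InnerProductSpace

variable {L M : ℕ} [NeZero L] [NeZero M] {N N' : ℕ}

/-- **The sectorised single-scale step, determinant-bound currency, plateau form.**  Data: thin and fat input families `F, F̃`
with `F̃F = F` and `Σ_ω F_ω(k) = 0 ⇒ F_ω(k) = 0`; an output family `F′`; an even input `G` without constant part; a slice
covariance `C` whose plateau conditions hold (`Σ_ω F_ω = 1` on the momenta of `supp C` and of `supp F′`) and whose sectorised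
propagator `C′ = S(F̃)ᵀ C S(F̃)` is replica-Gram-bounded with constant `κ` (`IsGramBoundedR`) and has row/column sums `≤ α`; a radius
`ρ > 0` with `θ = eα‖Ṽ‖_h/κ² < 1`, `Ṽ = sectorPreimage β F G`; overlap constants `(cr, cc)` of `E(F′)·S(F̃)`.  THEN `∫dμ_C e^{-G}` is a
unit and in every degree `m + 1`, `‖kernel (map (toLin' E(F′)) (effAction C G)) (m+1)‖_{ε_x} ≤ cr cc^m ε_x^m ρ^{-(m+1)} e‖Ṽ‖_h/(1-θ)`.
[cite: BenfattoGiulianiMastropietro2006, (2.77) with (2.71a) and (2.80)-(2.82)] -/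
theorem kernelNorm_sectorAnalysis_effAction_le_of_gramBounded_of_plateau
    {β : ℝ} (hβ : 0 < β) (F Ft : Fin N → FreqMomentum L M → ℂ) (hFF : ∀ ω k, Ft ω k * F ω k = F ω k)
    (hF0 : ∀ k, ∑ ω, F ω k = 0 → ∀ ω, F ω k = 0)
    (F' : Fin N' → FreqMomentum L M → ℂ) (G : HubbardGrassmann L M) (hG : G ∈ evenPart ℂ (HubbardFieldIdx L M))
    (hG0 : constPart ℂ G = 0)
    (C : Matrix (HubbardFieldIdx L M) (HubbardFieldIdx L M) ℂ)
    (hCpl : ∀ X Y, C X Y ≠ 0 → ∑ ω, F ω X.1.1 = 1 ∧ ∑ ω, F ω Y.1.1 = 1)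
    (hF'pl : ∀ (ω' : Fin N') (k : FreqMomentum L M), F' ω' k ≠ 0 → ∑ ω, F ω k = 1)
    {κ : ℝ} (hκ : 0 < κ)
    (hGB : IsGramBoundedR ((sectorSubMatrix L M β Ft).transpose * C * sectorSubMatrix L M β Ft) κ)
    {α : ℝ} (hα : 0 < α)
    (hrow : ∀ X, ∑ Y, ‖((sectorSubMatrix L M β Ft).transpose * C * sectorSubMatrix L M β Ft) X Y‖ ≤ α)
    (hcol : ∀ Y, ∑ X, ‖((sectorSubMatrix L M β Ft).transpose * C * sectorSubMatrix L M β Ft) X Y‖ ≤ α)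
    {ρ : ℝ} (hρ : 0 < ρ)
    (hθ : Real.exp 1 * α * normV (SpaceTimeIdx L M × SectorLeg N) κ ρ
      (fun m' => kernelNorm 1 (2 * m') (kernel ℂ (sectorPreimage β F G) (2 * m'))) / κ ^ 2 < 1)
    {cr cc : ℝ} (hcr0 : 0 ≤ cr) (hcc0 : 0 ≤ cc)
    (hrow' : ∀ X'', ∑ X', ‖(sectorAnalysisMatrix L M β F' * sectorSubMatrix L M β Ft) X'' X'‖ ≤ cr)
    (hcol' : ∀ X', ∑ X'', ‖(sectorAnalysisMatrix L M β F' * sectorSubMatrix L M β Ft) X'' X'‖ ≤ cc) :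
    IsUnit (effPartitionFn ℂ C G) ∧ ∀ m : ℕ,
      kernelNorm (imagTimeWeight β M) (m + 1)
          (kernel ℂ (ExteriorAlgebra.map (Matrix.toLin' (sectorAnalysisMatrix L M β F')) (effAction ℂ C G)) (m + 1)) ≤
        cr * cc ^ m * imagTimeWeight β M ^ m * (ρ⁻¹ ^ (m + 1) *
          (Real.exp 1 * normV (SpaceTimeIdx L M × SectorLeg N) κ ρ
            (fun m' => kernelNorm 1 (2 * m') (kernel ℂ (sectorPreimage β F G) (2 * m')))) /
            (1 - Real.exp 1 * α * normV (SpaceTimeIdx L M × SectorLeg N) κ ρ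
              (fun m' => kernelNorm 1 (2 * m') (kernel ℂ (sectorPreimage β F G) (2 * m'))) / κ ^ 2)) := by
  -- the step for `Ṽ` in the representation `(S, E)`
  have h := kernelNorm_kernel_map_effAction_le_of_gramBounded C (Matrix.toLin' (sectorSubMatrix L M β Ft))
    (Matrix.toLin' (sectorAnalysisMatrix L M β F')) (sectorPreimage β F G) (sectorPreimage_mem_evenPart β F hG)
    (by rw [constPart_sectorPreimage, hG0]) hκ (by simpa only [LinearMap.toMatrix'_toLin'] using hGB) hα
    (by simpa only [LinearMap.toMatrix'_toLin'] using hrow) (by simpa only [LinearMap.toMatrix'_toLin'] using hcol) hρ hθ hcr0 hcc0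
    (by simpa only [LinearMap.toMatrix'_toLin'] using hrow') (by simpa only [LinearMap.toMatrix'_toLin'] using hcol')
    (imagTimeWeight_nonneg hβ.le M)
  -- transfer from `map S Ṽ` to `G` (plateau identities)
  rw [effPartitionFn_map_sectorSub_sectorPreimage_of_plateau hβ.ne' F Ft hFF hF0 G C hCpl] at h
  simp_rw [map_sectorAnalysis_effAction_map_sectorPreimage_of_plateau hβ.ne' F Ft hFF hF0 F' G C hCpl hF'pl] at h
  exact h

/-- **The step in the sectorised `L¹–L^∞` norm, determinant-bound currency, plateau form**: under the hypotheses of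
`kernelNorm_sectorAnalysis_effAction_le_of_gramBounded_of_plateau`, for every degree `m + 1` and constraint set `A`,
`hubbardSectorKernelNorm β F' A (effAction C G) ≤ cr cc^m ε_x^m ρ^{-(m+1)} e‖Ṽ‖_h/(1-θ)`. [cite: BenfattoGiulianiMastropietro2006, §2.8 (2.77)] -/
theorem hubbardSectorKernelNorm_effAction_le_of_gramBounded_of_plateau
    {β : ℝ} (hβ : 0 < β) (F Ft : Fin N → FreqMomentum L M → ℂ) (hFF : ∀ ω k, Ft ω k * F ω k = F ω k)
    (hF0 : ∀ k, ∑ ω, F ω k = 0 → ∀ ω, F ω k = 0)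
    (F' : Fin N' → FreqMomentum L M → ℂ) (G : HubbardGrassmann L M) (hG : G ∈ evenPart ℂ (HubbardFieldIdx L M))
    (hG0 : constPart ℂ G = 0)
    (C : Matrix (HubbardFieldIdx L M) (HubbardFieldIdx L M) ℂ)
    (hCpl : ∀ X Y, C X Y ≠ 0 → ∑ ω, F ω X.1.1 = 1 ∧ ∑ ω, F ω Y.1.1 = 1)
    (hF'pl : ∀ (ω' : Fin N') (k : FreqMomentum L M), F' ω' k ≠ 0 → ∑ ω, F ω k = 1)
    {κ : ℝ} (hκ : 0 < κ)
    (hGB : IsGramBoundedR ((sectorSubMatrix L M β Ft).transpose * C * sectorSubMatrix L M β Ft) κ)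
    {α : ℝ} (hα : 0 < α)
    (hrow : ∀ X, ∑ Y, ‖((sectorSubMatrix L M β Ft).transpose * C * sectorSubMatrix L M β Ft) X Y‖ ≤ α)
    (hcol : ∀ Y, ∑ X, ‖((sectorSubMatrix L M β Ft).transpose * C * sectorSubMatrix L M β Ft) X Y‖ ≤ α)
    {ρ : ℝ} (hρ : 0 < ρ)
    (hθ : Real.exp 1 * α * normV (SpaceTimeIdx L M × SectorLeg N) κ ρ
      (fun m' => kernelNorm 1 (2 * m') (kernel ℂ (sectorPreimage β F G) (2 * m'))) / κ ^ 2 < 1)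
    {cr cc : ℝ} (hcr0 : 0 ≤ cr) (hcc0 : 0 ≤ cc)
    (hrow' : ∀ X'', ∑ X', ‖(sectorAnalysisMatrix L M β F' * sectorSubMatrix L M β Ft) X'' X'‖ ≤ cr)
    (hcol' : ∀ X', ∑ X'', ‖(sectorAnalysisMatrix L M β F' * sectorSubMatrix L M β Ft) X'' X'‖ ≤ cc)
    (m : ℕ) (A : Finset (Fin (m + 1) → SectorLeg N')) :
    hubbardSectorKernelNorm L M β F' A (effAction ℂ C G) ≤
      cr * cc ^ m * imagTimeWeight β M ^ m * (ρ⁻¹ ^ (m + 1) *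
        (Real.exp 1 * normV (SpaceTimeIdx L M × SectorLeg N) κ ρ
          (fun m' => kernelNorm 1 (2 * m') (kernel ℂ (sectorPreimage β F G) (2 * m')))) /
          (1 - Real.exp 1 * α * normV (SpaceTimeIdx L M × SectorLeg N) κ ρ
            (fun m' => kernelNorm 1 (2 * m') (kernel ℂ (sectorPreimage β F G) (2 * m'))) / κ ^ 2)) :=
  (hubbardSectorKernelNorm_le_kernelNorm_map hβ.le F' A _).trans
    ((kernelNorm_sectorAnalysis_effAction_le_of_gramBounded_of_plateau hβ F Ft hFF hF0 F' G hG hG0 C hCpl hF'pl hκ hGB hα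
      hrow hcol hρ hθ hcr0 hcc0 hrow' hcol').2 m)

/-- **S1, determinant-bound currency, plateau form, with the input norm in the sectorised currency** (BGM 2006, (2.77)):
with `N̄(m') = ε_x · hubbardSectorKernelNorm β F univ G` (degree `2m'`), `‖G‖_h = normV Γ' κ ρ N̄`, `θ̄ = eα‖G‖_h/κ²`: if `θ̄ < 1`
then `∫dμ_C e^{-G}` is a unit and, for every degree `m + 1` and constraint set `A`,
`hubbardSectorKernelNorm β F' A (effAction C G) ≤ cr cc^m ε_x^m ρ^{-(m+1)} e‖G‖_h/(1-θ̄)` — for EVERY even `G` without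
constant part, with a determinant bound `IsGramBoundedR (S(F̃)ᵀ C S(F̃)) κ` on the sectorised slice, the plateau of `F` being
required only over the slice and the output family. [cite: BenfattoGiulianiMastropietro2006, §2.8 (2.77)] -/
theorem hubbardSectorKernelNorm_effAction_le_of_sectorNorm_of_gramBounded_of_plateau
    {β : ℝ} (hβ : 0 < β) (F Ft : Fin N → FreqMomentum L M → ℂ) (hFF : ∀ ω k, Ft ω k * F ω k = F ω k)
    (hF0 : ∀ k, ∑ ω, F ω k = 0 → ∀ ω, F ω k = 0)
    (F' : Fin N' → FreqMomentum L M → ℂ) (G : HubbardGrassmann L M) (hG : G ∈ evenPart ℂ (HubbardFieldIdx L M))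
    (hG0 : constPart ℂ G = 0)
    (C : Matrix (HubbardFieldIdx L M) (HubbardFieldIdx L M) ℂ)
    (hCpl : ∀ X Y, C X Y ≠ 0 → ∑ ω, F ω X.1.1 = 1 ∧ ∑ ω, F ω Y.1.1 = 1)
    (hF'pl : ∀ (ω' : Fin N') (k : FreqMomentum L M), F' ω' k ≠ 0 → ∑ ω, F ω k = 1)
    {κ : ℝ} (hκ : 0 < κ)
    (hGB : IsGramBoundedR ((sectorSubMatrix L M β Ft).transpose * C * sectorSubMatrix L M β Ft) κ)
    {α : ℝ} (hα : 0 < α)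
    (hrow : ∀ X, ∑ Y, ‖((sectorSubMatrix L M β Ft).transpose * C * sectorSubMatrix L M β Ft) X Y‖ ≤ α)
    (hcol : ∀ Y, ∑ X, ‖((sectorSubMatrix L M β Ft).transpose * C * sectorSubMatrix L M β Ft) X Y‖ ≤ α)
    {ρ : ℝ} (hρ : 0 < ρ)
    (hθ : Real.exp 1 * α * normV (SpaceTimeIdx L M × SectorLeg N) κ ρ
      (fun m' => imagTimeWeight β M *
        hubbardSectorKernelNorm L M β F (univ : Finset (Fin (2 * m') → SectorLeg N)) G) / κ ^ 2 < 1)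
    {cr cc : ℝ} (hcr0 : 0 ≤ cr) (hcc0 : 0 ≤ cc)
    (hrow' : ∀ X'', ∑ X', ‖(sectorAnalysisMatrix L M β F' * sectorSubMatrix L M β Ft) X'' X'‖ ≤ cr)
    (hcol' : ∀ X', ∑ X'', ‖(sectorAnalysisMatrix L M β F' * sectorSubMatrix L M β Ft) X'' X'‖ ≤ cc)
    (m : ℕ) (A : Finset (Fin (m + 1) → SectorLeg N')) :
    IsUnit (effPartitionFn ℂ C G) ∧
      hubbardSectorKernelNorm L M β F' A (effAction ℂ C G) ≤
        cr * cc ^ m * imagTimeWeight β M ^ m * (ρ⁻¹ ^ (m + 1) *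
          (Real.exp 1 * normV (SpaceTimeIdx L M × SectorLeg N) κ ρ
            (fun m' => imagTimeWeight β M *
              hubbardSectorKernelNorm L M β F (univ : Finset (Fin (2 * m') → SectorLeg N)) G)) /
            (1 - Real.exp 1 * α * normV (SpaceTimeIdx L M × SectorLeg N) κ ρ
              (fun m' => imagTimeWeight β M *
                hubbardSectorKernelNorm L M β F (univ : Finset (Fin (2 * m') → SectorLeg N)) G) / κ ^ 2)) := by
  set nV : ℝ := normV (SpaceTimeIdx L M × SectorLeg N) κ ρ
    (fun m' => kernelNorm 1 (2 * m') (kernel ℂ (sectorPreimage β F G) (2 * m'))) with hnV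
  set nVbar : ℝ := normV (SpaceTimeIdx L M × SectorLeg N) κ ρ (fun m' => imagTimeWeight β M *
    hubbardSectorKernelNorm L M β F (univ : Finset (Fin (2 * m') → SectorLeg N)) G) with hnVbar
  have hle : nV ≤ nVbar := normV_mono hκ.le hρ.le fun m' => kernelNorm_kernel_sectorPreimage_two_mul_le hβ.le F G hG0 m'
  have hnV0 : 0 ≤ nV := normV_nonneg hκ.le hρ.le fun m' => kernelNorm_nonneg zero_le_one _ _
  have hθ' : Real.exp 1 * α * nV / κ ^ 2 < 1 := lt_of_le_of_lt (by gcongr) hθ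
  obtain ⟨hunit, hstep⟩ := kernelNorm_sectorAnalysis_effAction_le_of_gramBounded_of_plateau hβ F Ft hFF hF0 F' G hG hG0 C hCpl
    hF'pl hκ hGB hα hrow hcol hρ hθ' hcr0 hcc0 hrow' hcol'
  refine ⟨hunit, (hubbardSectorKernelNorm_le_kernelNorm_map hβ.le F' A _).trans ((hstep m).trans ?_)⟩
  have hB := step_bound_mono hκ hα hnV0 hle hθ
  have hε : 0 ≤ imagTimeWeight β M := imagTimeWeight_nonneg hβ.le M
  calc cr * cc ^ m * imagTimeWeight β M ^ m * (ρ⁻¹ ^ (m + 1) * (Real.exp 1 * nV) / (1 - Real.exp 1 * α * nV / κ ^ 2))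
      = cr * cc ^ m * imagTimeWeight β M ^ m * ρ⁻¹ ^ (m + 1) * (Real.exp 1 * nV / (1 - Real.exp 1 * α * nV / κ ^ 2)) := by
        ring
    _ ≤ cr * cc ^ m * imagTimeWeight β M ^ m * ρ⁻¹ ^ (m + 1) * (Real.exp 1 * nVbar / (1 - Real.exp 1 * α * nVbar / κ ^ 2)) :=
        mul_le_mul_of_nonneg_left hB (by positivity)
    _ = _ := by ring

end Step

end Literature.MathematicalPhysics.QuantumLattice

end
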